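import Literature.Geometry.GeometricMeasureTheory.EilenbergInequality
import HarnessLib

/-!
# Eilenberg's inequality for the multiplicity (Federer 2.10.25, `k = 0`) — the proof

Topic `Literature/Geometry/GeometricMeasureTheory`. THEOREMS ONLY (no definitions, no named facts):
this file DISCHARGES the named fact
`Literature.Geometry.GeometricMeasureTheory.Federer1969_thm_2_10_25_zero` of the sibling file
`EilenbergInequality.lean` by proving

* `Federer1969_thm_2_10_25_zero_holds : Federer1969_thm_2_10_25_zero` — for a `K`-Lipschitz map
  `f : X → Y` of metric spaces, any `A ⊆ X` and `0 ≤ m`,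
  `∫⁻ #(A ∩ f⁻¹{y}) dμH[m](y) ≤ K ^ m · μH[m](A)` (Mathlib's Hausdorff measures and lower integral),

together with the three steps of the argument as reusable theorems:
`exists_cover_ediam_le_of_hausdorffMeasure_ne_top` (countable small covers of a set of finite
`μH[m]`-measure), `encard_fiber_le_liminf_tsum_indicator` (pointwise step) and
`lintegral_tsum_indicator_toMeasurable_image_le` (integral step).

Source followed: H. Federer, *Geometric Measure Theory* (1969) [Federer1969], held copy
`book:federernd-geometric-measure-theory` (text-layer page = printed page − 23). The statement is
2.10.25 with `k = 0` (printed p. 188); the proof formalised here is NOT Federer's proof of 2.10.25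
(which, for general `k`, goes through the weighted covering numbers `λ_δ` of 2.10.24 and the
increasing-sets lemma 2.10.22, and uses the proviso "`Y` boundedly compact") but the partition
argument of 2.10.10–2.10.11 (printed p. 176), which for `k = 0` proves the inequality with no
hypothesis on `X`, `A` or `Y`; see the section docstring below for the two deviations
(measurable hulls, Fatou instead of monotone convergence). In particular the instance
`[ProperSpace Y]` carried by the named fact is not used.

## References

* H. Federer, *Geometric Measure Theory*, Grundlehren 153, Springer (1969): 2.10.25 (p. 188),
  2.10.10–2.10.11 (p. 176), 2.10.2 (1) (normalisation, immaterial for `k = 0`). [Federer1969]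
-/

noncomputable section

open scoped ENNReal NNReal MeasureTheory
open MeasureTheory Set

namespace Literature.Geometry.GeometricMeasureTheory

/-! ## The argument (the `k = 0` case is Federer 2.10.10–2.10.11 in disguise)

Federer's printed proof of 2.10.25 (general `k`) runs through the weighted-covering machinery
2.10.22–2.10.24 and genuinely uses the proviso on `Y`. For `k = 0` the integrand is the
multiplicity `N(f|A, ·)` and the **partition argument of 2.10.10–2.10.11** (p. 176) suffices, with
no hypothesis on `X`, `A` or `Y` at all: cut a measurable hull `A' ⊇ A` (`toMeasurable`) into
countably many pairwise disjoint measurable pieces `S n` of diameter `≤ δ`; then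
`Σ_n 𝟙_{f(S n)}(y)` dominates the number of `δ`-separated points of the fibre `A ∩ f⁻¹{y}`, while
`Σ_n μH[m] (f (S n)) ≤ K ^ m Σ_n μH[m] (S n) = K ^ m μH[m] (⋃ S n) ≤ K ^ m μH[m] A` by
`LipschitzWith.hausdorffMeasure_image_le` and countable additivity. Two deviations from the
printed road, both forced by working with arbitrary `A` and Mathlib's (lower) integral `∫⁻`:
`f (S n)` is replaced by its measurable hull `toMeasurable μH[m] (f '' S n)` (same measure), so
that the majorants `g_δ = Σ_n 𝟙_{T n}` are measurable, and monotone convergence along nested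
partitions (2.10.10) is replaced by Fatou's lemma (`MeasureTheory.lintegral_liminf_le`) along
`δ = 1/j → 0`, using `#(A ∩ f⁻¹{y}) ≤ liminf_j g_{1/j}(y)`.
-/

section Discharge

open Filter Metric
open scoped _root_.Topology

/-- A set of non-infinite `μH[m]`-measure has, for every `r > 0`, a countable cover by sets of
diameter `≤ r` (immediate from the definition of `μH[m]`, `MeasureTheory.Measure.hausdorffMeasure_apply`:
otherwise the inner infimum is over the empty family). [folklore] -/
theorem exists_cover_ediam_le_of_hausdorffMeasure_ne_top {X : Type*} [EMetricSpace X]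
    [MeasurableSpace X] [BorelSpace X] {m : ℝ} {A : Set X} (hA : (μH[m] : Measure X) A ≠ ⊤)
    {r : ℝ≥0∞} (hr : 0 < r) :
    ∃ t : ℕ → Set X, A ⊆ ⋃ n, t n ∧ ∀ n, ediam (t n) ≤ r := by
  rw [Measure.hausdorffMeasure_apply] at hA
  have h : (⨅ (t : ℕ → Set X) (_ : A ⊆ ⋃ n, t n) (_ : ∀ n, ediam (t n) ≤ r),
      ∑' n, ⨆ _ : (t n).Nonempty, ediam (t n) ^ m) < ⊤ := by
    refine lt_of_le_of_lt ?_ hA.lt_top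
    exact le_iSup₂ (f := fun (r : ℝ≥0∞) (_ : 0 < r) => ⨅ (t : ℕ → Set X) (_ : A ⊆ ⋃ n, t n)
      (_ : ∀ n, ediam (t n) ≤ r), ∑' n, ⨆ _ : (t n).Nonempty, ediam (t n) ^ m) r hr
  simp only [iInf_lt_iff] at h
  obtain ⟨t, ht, hd, -⟩ := h
  exact ⟨t, ht, hd⟩

/-- **Pointwise step** (Federer 2.10.10, "`Σ_{S ∈ H_j} c_S(y) ↑ N(f|A, y)`", in `liminf` form).
If for every `j` the sets `S j n` (`n : ℕ`) cover `A` and have diameter `≤ δ j → 0`, and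
`T j n ⊇ f (S j n)`, then the multiplicity `#(A ∩ f⁻¹{y})` is at most
`liminf_j Σ_n 𝟙_{T j n}(y)`: any finite subset of the fibre is eventually `δ j`-separated, so its
points lie in pairwise distinct pieces `S j n`, each of whose `T j n` contains `y`.
[cite: Federer1969, 2.10.10 (p. 176)] -/
theorem encard_fiber_le_liminf_tsum_indicator {X Y : Type*} [EMetricSpace X] {f : X → Y}
    {A : Set X} (δ : ℕ → ℝ≥0∞)
    (hδ : Tendsto δ atTop (𝓝 0)) (S : ℕ → ℕ → Set X) (T : ℕ → ℕ → Set Y)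
    (hcover : ∀ j, A ⊆ ⋃ n, S j n) (hdiam : ∀ j n, ediam (S j n) ≤ δ j)
    (hT : ∀ j n, f '' S j n ⊆ T j n) (y : Y) :
    ((A ∩ f ⁻¹' {y}).encard : ℝ≥0∞) ≤
      liminf (fun j => ∑' n, (T j n).indicator (1 : Y → ℝ≥0∞) y) atTop := by
  -- finite subsets of the fibre first
  have key : ∀ s : Finset X, (↑s : Set X) ⊆ A ∩ f ⁻¹' {y} →
      ((s.card : ℕ) : ℝ≥0∞) ≤ liminf (fun j => ∑' n, (T j n).indicator (1 : Y → ℝ≥0∞) y) atTop := by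
    intro s hs
    -- eventually the points of `s` are `δ j`-separated
    have hsep : ∀ᶠ j in atTop, ∀ x ∈ s, ∀ x' ∈ s, x ≠ x' → δ j < edist x x' := by
      refine (eventually_all_finset s).2 fun x _ => (eventually_all_finset s).2 fun x' _ => ?_
      by_cases hne : x = x'
      · exact Eventually.of_forall fun j h => (h hne).elim
      · exact (hδ.eventually_lt_const (edist_pos.2 hne)).mono fun j hj _ => hj
    refine le_liminf_of_le (h := hsep.mono fun j hj => ?_)
    -- index of the piece containing each point of `s`
    have hxS : ∀ x ∈ s, ∃ n, x ∈ S j n := fun x hx => mem_iUnion.1 (hcover j (hs hx).1)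
    choose! idx hidx using hxS
    have hinj : Set.InjOn idx ↑s := by
      intro x hx x' hx' h
      by_contra hne
      have hx'S : x' ∈ S j (idx x) := by rw [h]; exact hidx x' hx'
      exact absurd (hj x hx x' hx' hne)
        (not_lt.2 ((edist_le_ediam_of_mem (hidx x hx) hx'S).trans (hdiam j _)))
    have hyT : ∀ x ∈ s, y ∈ T j (idx x) := fun x hx =>
      hT j _ ⟨x, hidx x hx, (hs hx).2⟩
    classical
    calc ((s.card : ℕ) : ℝ≥0∞) = ((s.image idx).card : ℝ≥0∞) := by
          rw [Finset.card_image_of_injOn hinj]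
      _ = ∑ n ∈ s.image idx, (1 : ℝ≥0∞) := by simp
      _ = ∑ n ∈ s.image idx, (T j n).indicator (1 : Y → ℝ≥0∞) y :=
          Finset.sum_congr rfl fun n hn => by
            obtain ⟨x, hx, rfl⟩ := Finset.mem_image.1 hn
            rw [indicator_of_mem (hyT x hx)]
            rfl
      _ ≤ ∑' n, (T j n).indicator (1 : Y → ℝ≥0∞) y := ENNReal.sum_le_tsum _
  rcases (A ∩ f ⁻¹' {y}).finite_or_infinite with hfin | hinf
  · rw [hfin.encard_eq_coe_toFinset_card, ENat.toENNReal_coe]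
    exact key _ (by simp)
  · rw [hinf.encard_eq, ENat.toENNReal_top, top_le_iff]
    by_contra hne
    obtain ⟨n, hn⟩ := ENNReal.exists_nat_gt hne
    obtain ⟨t, ht, htc⟩ := hinf.exists_subset_card_eq n
    exact absurd (htc ▸ key t ht) (not_le.2 hn)

/-- **Integral step** (Federer 2.10.11, "`ζ(S) = 𝓗ᵐ[f(S)] ≤ (Lip f)ᵐ 𝓗ᵐ(S)`" summed over a
partition). For pairwise disjoint measurable `S n ⊆ toMeasurable μH[m] A` and `f` `K`-Lipschitz,
`∫⁻ Σ_n 𝟙_{toMeasurable μH[m] (f (S n))} dμH[m] = Σ_n μH[m] (f (S n)) ≤ K ^ m μH[m] A`.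
[cite: Federer1969, 2.10.11 (p. 176)] -/
theorem lintegral_tsum_indicator_toMeasurable_image_le {X Y : Type*} [MetricSpace X]
    [MeasurableSpace X] [BorelSpace X] [MetricSpace Y] [MeasurableSpace Y] [BorelSpace Y]
    {K : ℝ≥0} {f : X → Y} (hf : LipschitzWith K f) {m : ℝ} (hm : 0 ≤ m) (A : Set X) (S : ℕ → Set X)
    (hSm : ∀ n, MeasurableSet (S n)) (hSd : Pairwise (Function.onFun Disjoint S))
    (hSA : ∀ n, S n ⊆ toMeasurable (μH[m] : Measure X) A) :
    ∫⁻ y, ∑' n, (toMeasurable (μH[m] : Measure Y) (f '' S n)).indicator (1 : Y → ℝ≥0∞) y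
        ∂(μH[m] : Measure Y) ≤ (K : ℝ≥0∞) ^ m * (μH[m] : Measure X) A := by
  calc ∫⁻ y, ∑' n, (toMeasurable (μH[m] : Measure Y) (f '' S n)).indicator (1 : Y → ℝ≥0∞) y
        ∂(μH[m] : Measure Y)
      = ∑' n, ∫⁻ y, (toMeasurable (μH[m] : Measure Y) (f '' S n)).indicator (1 : Y → ℝ≥0∞) y
          ∂(μH[m] : Measure Y) :=
        lintegral_tsum fun n =>
          (measurable_one.indicator (measurableSet_toMeasurable _ _)).aemeasurable
    _ = ∑' n, (μH[m] : Measure Y) (f '' S n) :=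
        tsum_congr fun n => by
          rw [lintegral_indicator_one (measurableSet_toMeasurable _ _), measure_toMeasurable]
    _ ≤ ∑' n, (K : ℝ≥0∞) ^ m * (μH[m] : Measure X) (S n) :=
        ENNReal.tsum_le_tsum fun n => hf.hausdorffMeasure_image_le hm _
    _ = (K : ℝ≥0∞) ^ m * (μH[m] : Measure X) (⋃ n, S n) := by
        rw [ENNReal.tsum_mul_left, measure_iUnion hSd hSm]
    _ ≤ (K : ℝ≥0∞) ^ m * (μH[m] : Measure X) A :=
        mul_le_mul_right ((measure_mono (iUnion_subset hSA)).trans_eq (measure_toMeasurable A)) _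

/-- **Federer 1969, 2.10.25 (`k = 0`) holds** — discharge of `Federer1969_thm_2_10_25_zero`:
`∫⁻ #(A ∩ f⁻¹{y}) dμH[m](y) ≤ K ^ m · μH[m](A)` for `f` `K`-Lipschitz between metric spaces and
any `A`, `0 ≤ m`. Proof (see the section docstring): trivial when `K ^ m = 0` (`f` constant, the
single fibre is a `μH[m]`-null point as `m > 0`) or `μH[m] A = ∞`; otherwise Federer's partition
argument 2.10.10–2.10.11 with measurable hulls and Fatou. The hypothesis `ProperSpace Y` of the
named fact (Federer's proviso for general `k`) is not needed for `k = 0`.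
[cite: Federer1969, Thm. 2.10.25 (k = 0), via 2.10.10–2.10.11 (pp. 176, 188)] -/
theorem Federer1969_thm_2_10_25_zero_holds : Federer1969_thm_2_10_25_zero := by
  intro X Y _ _ _ _ _ _ _ K f hf A m hm
  -- Case 1: `K ^ m = 0`, i.e. `K = 0` and `0 < m`: `f` is constant, one fibre, a null point.
  by_cases hKm : (K : ℝ≥0∞) ^ m = 0
  · obtain ⟨hK0, hmpos⟩ | ⟨htop, _⟩ := ENNReal.rpow_eq_zero_iff.1 hKm
    swap
    · exact absurd htop ENNReal.coe_ne_top
    rw [hKm, zero_mul]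
    rcases A.eq_empty_or_nonempty with rfl | ⟨a, ha⟩
    · simp
    have hconst : ∀ x, f x = f a := fun x => edist_le_zero.1 (by simpa [hK0] using hf x a)
    have hle : ∀ y, ((A ∩ f ⁻¹' {y}).encard : ℝ≥0∞) ≤
        ({f a} : Set Y).indicator (fun _ => (⊤ : ℝ≥0∞)) y := by
      intro y
      by_cases hy : y = f a
      · subst hy
        simp
      · have hempty : A ∩ f ⁻¹' {y} = ∅ := by
          ext x
          simp only [mem_inter_iff, mem_preimage, mem_singleton_iff, mem_empty_iff_false,
            iff_false, not_and]
          exact fun _ hx => hy (hx ▸ hconst x)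
        simp [hempty]
    haveI := Measure.nullSingletonClass_hausdorff Y hmpos
    calc ∫⁻ y, ((A ∩ f ⁻¹' {y}).encard : ℝ≥0∞) ∂(μH[m] : Measure Y)
        ≤ ∫⁻ y, ({f a} : Set Y).indicator (fun _ => (⊤ : ℝ≥0∞)) y ∂(μH[m] : Measure Y) :=
          lintegral_mono hle
      _ ≤ ⊤ * (μH[m] : Measure Y) {f a} := lintegral_indicator_const_le _ _
      _ = 0 := by rw [measure_singleton, mul_zero]
  -- Case 2: `μH[m] A = ∞` (and `K ^ m ≠ 0`): the right-hand side is `∞`.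
  by_cases hA : (μH[m] : Measure X) A = ⊤
  · rw [hA, ENNReal.mul_top hKm]
    exact le_top
  -- Case 3 (main): covers of `A` at scale `1/j`, made measurable and pairwise disjoint inside the
  -- measurable hull of `A`; measurable hulls of the images; Fatou.
  have hcov : ∀ j : ℕ, ∃ t : ℕ → Set X, A ⊆ ⋃ n, t n ∧ ∀ n, ediam (t n) ≤ (j : ℝ≥0∞)⁻¹ :=
    fun j => exists_cover_ediam_le_of_hausdorffMeasure_ne_top hA
      (ENNReal.inv_pos.2 (ENNReal.natCast_ne_top j))
  choose t htA htd using hcov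
  -- the pieces `S j n` and the hulls `T j n`
  set S : ℕ → ℕ → Set X := fun j n =>
    toMeasurable (μH[m] : Measure X) A ∩ disjointed (fun n => closure (t j n)) n with hS
  set T : ℕ → ℕ → Set Y := fun j n => toMeasurable (μH[m] : Measure Y) (f '' S j n) with hT
  have hSm : ∀ j n, MeasurableSet (S j n) := fun j n =>
    (measurableSet_toMeasurable _ _).inter
      (MeasurableSet.disjointed (fun n => isClosed_closure.measurableSet) n)
  have hSd : ∀ j, Pairwise (Function.onFun Disjoint (S j)) := fun j =>
    (disjoint_disjointed fun n => closure (t j n)).mono fun a b h =>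
      h.mono inter_subset_right inter_subset_right
  have hSA : ∀ j n, S j n ⊆ toMeasurable (μH[m] : Measure X) A := fun j n => inter_subset_left
  have hcover : ∀ j, A ⊆ ⋃ n, S j n := by
    intro j x hx
    have hx' : x ∈ ⋃ n, disjointed (fun n => closure (t j n)) n := by
      rw [iUnion_disjointed]
      obtain ⟨n, hn⟩ := mem_iUnion.1 (htA j hx)
      exact mem_iUnion.2 ⟨n, subset_closure hn⟩
    obtain ⟨n, hn⟩ := mem_iUnion.1 hx'
    exact mem_iUnion.2 ⟨n, subset_toMeasurable _ _ hx, hn⟩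
  have hdiam : ∀ j n, ediam (S j n) ≤ (j : ℝ≥0∞)⁻¹ := fun j n =>
    calc ediam (S j n) ≤ ediam (closure (t j n)) :=
          ediam_mono (inter_subset_right.trans (disjointed_le (fun n => closure (t j n)) n))
      _ = ediam (t j n) := ediam_closure _
      _ ≤ _ := htd j n
  have hTS : ∀ j n, f '' S j n ⊆ T j n := fun j n => subset_toMeasurable _ _
  have hgm : ∀ j, Measurable fun y => ∑' n, (T j n).indicator (1 : Y → ℝ≥0∞) y := fun j => by
    simp_rw [ENNReal.tsum_eq_iSup_sum]
    exact .iSup fun s => s.measurable_fun_sum fun n _ =>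
      measurable_one.indicator (measurableSet_toMeasurable _ _)
  calc ∫⁻ y, ((A ∩ f ⁻¹' {y}).encard : ℝ≥0∞) ∂(μH[m] : Measure Y)
      ≤ ∫⁻ y, liminf (fun j => ∑' n, (T j n).indicator (1 : Y → ℝ≥0∞) y) atTop
          ∂(μH[m] : Measure Y) :=
        lintegral_mono fun y => encard_fiber_le_liminf_tsum_indicator (fun j : ℕ => (j : ℝ≥0∞)⁻¹)
          ENNReal.tendsto_inv_nat_nhds_zero S T hcover hdiam hTS y
    _ ≤ liminf (fun j => ∫⁻ y, ∑' n, (T j n).indicator (1 : Y → ℝ≥0∞) y ∂(μH[m] : Measure Y))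
          atTop := lintegral_liminf_le hgm
    _ ≤ (K : ℝ≥0∞) ^ m * (μH[m] : Measure X) A :=
        liminf_le_of_le (h := fun b hb => hb.exists.elim fun j hj => hj.trans
          (lintegral_tsum_indicator_toMeasurable_image_le hf hm A (S j) (hSm j) (hSd j) (hSA j)))

end Discharge

end Literature.Geometry.GeometricMeasureTheory

end
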